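import Literature.MathematicalPhysics.QuantumFieldTheory.WightmanProofs
import Literature.MathematicalPhysics.QuantumLattice.WightmanAnalyticContinuation
import Literature.Analysis.Complex.PositiveKernelContinuation
import Mathlib.Analysis.Calculus.BumpFunction.Normed
import Mathlib.Analysis.Calculus.BumpFunction.FiniteDimension
import Mathlib.MeasureTheory.Integral.Prod
import HarnessLib

/-!
# Wightman positivity from reflection positivity, I: the OS kernel at Euclidean points

Support file for the discharge of `Literature.MathematicalPhysics.QuantumFieldTheory.OS1973_positiveDefinite`
(Osterwalder–Schrader I (1973), §4.3: property (e) of Streater–Wightman for the boundary values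
of an OS continuation family). The route is V. Glaser's ("the Euclidean Green's functions
satisfying the OS postulates are restrictions of functions analytic in the whole causal domain
and satisfy the positivity condition there", Comm. Math. Phys. 37 (1974)): with the time-shift
extension `𝔚ext` (`tubeExtension`) of the continued Schwinger functions, the **OS kernel**

  `𝕂 (⟨p, z⟩, ⟨q, w⟩) = 𝔚ext_{p+q} (conj z_{p-1}, …, conj z_0, w_0, …, w_{q-1})`

on complex configurations of all degrees is positive-semidefinite — first at time-ordered
Euclidean points (this file, from E2), then on the tube (the sequel `OSPositivityTube`, by
Glaser's lemma `Literature.Analysis.Complex.isPosSemidefKernelOn_halfPlane_of_ofReal`), whence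
positivity of the boundary values (`WightmanPositivityProofs`).

Contents:

* `finAppendMeasurableEquiv`, `integral_finAppend`, `integral_finAppend_eq_integral_integral`:
  Lebesgue measure on `(Fin (p+q) → E)` is the product of the measures on `(Fin p → E)` and
  `(Fin q → E)` under `Fin.append`;
* imaginary-time profiles: configurations whose imaginary parts are `t_k ê₀` with `t` strictly
  increasing lie in the relative tube (`mem_relForwardTube_of_profile`), and in the forward
  tube if moreover `t > 0`; `differentiableOn_tubeExtension` (the openness of the relative
  tube is `Literature.MathematicalPhysics.QuantumLattice.isOpen_relForwardTube` of `WightmanAnalyticContinuation`);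
* the OS kernel `osKernel 𝔚` on `Σ p, (Fin p → Fin (d+1) → ℂ)` and its Euclidean values;
* **E2 in Gram form** (`IsOSReflectionPositive.sum_nonneg`): for any finite family of positive-time
  test functions `G_i` of degrees `n_i` (repetitions of degrees allowed) and coefficients `c_i`,
  `∑ᵢⱼ conj cᵢ cⱼ 𝔖_{nᵢ+nⱼ}(ΘGᵢ* ⊗ Gⱼ) ≥ 0` — OS (4.3) "this form is positive semidefinite due to
  (E2)";
* **the Schwinger pairing through the continuation** (`schwinger_osPairing_eq_integral`): for
  compactly supported time-ordered `F, G`,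
  `𝔖_{p+q}(ΘF* ⊗ G) = ∫∫ 𝕂(⟨p, ι x⟩, ⟨q, ι y⟩) conj F(x) G(y) dx dy` (E1 + `tubeExtension`);
* **Step 1 of the Glaser route** (`isPosSemidefKernelOn_osKernel_euclid`): `𝕂` is
  positive-semidefinite on time-ordered Euclidean points (normalised bump functions shrinking to
  the points, E2 in Gram form, continuity of `𝔚ext`, stability of positive-semidefiniteness
  under pointwise limits).

## References

* K. Osterwalder, R. Schrader, Comm. Math. Phys. 31 (1973) 83–112, §4.1 (4.3), §4.3.
  [OsterwalderSchraderCMP1973]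
* V. Glaser, Comm. Math. Phys. 37 (1974) 257–272. [GlaserCMP1974]
-/

noncomputable section

open MeasureTheory Filter Complex ComplexConjugate Metric Set
open scoped Topology ComplexOrder SchwartzMap BigOperators
open Literature.MathematicalPhysics.QuantumLattice Literature.Analysis.Complex

namespace Literature.MathematicalPhysics.QuantumFieldTheory

/-! ### Appending configurations and Lebesgue measure -/

section Append

variable {E : Type*} [MeasurableSpace E]

/-- The measurable equivalence `(Fin p → E) × (Fin q → E) ≃ᵐ (Fin (p + q) → E)` given by
appending, `(x, y) ↦ Fin.append x y` (composite of Mathlib's `sumPiEquivProdPi` and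
`piCongrLeft finSumFinEquiv`). [folklore] -/
def finAppendMeasurableEquiv (p q : ℕ) : (Fin p → E) × (Fin q → E) ≃ᵐ (Fin (p + q) → E) :=
  (MeasurableEquiv.sumPiEquivProdPi fun _ : Fin p ⊕ Fin q => E).symm.trans
    (MeasurableEquiv.piCongrLeft (fun _ : Fin (p + q) => E) finSumFinEquiv)

/-- `finAppendMeasurableEquiv` is `Fin.append`. [folklore] -/
@[simp]
theorem finAppendMeasurableEquiv_apply (p q : ℕ) (xy : (Fin p → E) × (Fin q → E)) :
    finAppendMeasurableEquiv p q xy = Fin.append xy.1 xy.2 := by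
  funext k
  simp only [finAppendMeasurableEquiv, MeasurableEquiv.trans_apply,
    MeasurableEquiv.coe_piCongrLeft, MeasurableEquiv.coe_sumPiEquivProdPi_symm]
  refine Fin.addCases (fun i => ?_) (fun j => ?_) k
  · rw [← finSumFinEquiv_apply_left, Equiv.piCongrLeft_apply_apply, finSumFinEquiv_apply_left,
      Fin.append_left]
    rfl
  · rw [← finSumFinEquiv_apply_right, Equiv.piCongrLeft_apply_apply, finSumFinEquiv_apply_right,
      Fin.append_right]
    rfl

end Append

section AppendIntegral

variable {E : Type*} [MeasureSpace E] [SigmaFinite (volume : Measure E)]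
  {F' : Type*} [NormedAddCommGroup F'] [NormedSpace ℝ F']

/-- `finAppendMeasurableEquiv` preserves Lebesgue (product) measure. [folklore] -/
theorem measurePreserving_finAppendMeasurableEquiv (p q : ℕ) :
    MeasurePreserving (finAppendMeasurableEquiv (E := E) p q) volume volume :=
  (volume_measurePreserving_piCongrLeft (fun _ : Fin (p + q) => E) finSumFinEquiv).comp
    (volume_measurePreserving_sumPiEquivProdPi_symm fun _ : Fin p ⊕ Fin q => E)

/-- **Splitting a configuration integral at an append point**:
`∫ G(z) dz = ∫ G(x ⧺ y) d(x, y)` over `(Fin (p+q) → E)` versus `(Fin p → E) × (Fin q → E)`.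
[folklore] -/
theorem integral_finAppend (p q : ℕ) (G : (Fin (p + q) → E) → F') :
    ∫ z, G z = ∫ xy : (Fin p → E) × (Fin q → E), G (Fin.append xy.1 xy.2) := by
  rw [← (measurePreserving_finAppendMeasurableEquiv (E := E) p q).integral_comp' G]
  simp only [finAppendMeasurableEquiv_apply]

omit [NormedSpace ℝ F'] in
/-- Integrability transfers along `Fin.append`. [folklore] -/
theorem integrable_comp_finAppend_iff (p q : ℕ) (G : (Fin (p + q) → E) → F') :
    Integrable (fun xy : (Fin p → E) × (Fin q → E) => G (Fin.append xy.1 xy.2)) ↔ Integrable G := by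
  have h := (measurePreserving_finAppendMeasurableEquiv (E := E) p q).integrable_comp_emb
    (finAppendMeasurableEquiv (E := E) p q).measurableEmbedding (g := G)
  simp only [Function.comp_def, finAppendMeasurableEquiv_apply] at h
  exact h

/-- **Fubini at an append point**: for integrable `G`,
`∫ G(z) dz = ∫ (∫ G(x ⧺ y) dy) dx`. [folklore] -/
theorem integral_finAppend_eq_integral_integral (p q : ℕ) {G : (Fin (p + q) → E) → F'}
    (hG : Integrable G) :
    ∫ z, G z = ∫ x : Fin p → E, ∫ y : Fin q → E, G (Fin.append x y) := by
  rw [integral_finAppend, Measure.volume_eq_prod, integral_prod]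
  exact (Measure.volume_eq_prod (α := Fin p → E) (β := Fin q → E)) ▸
    (integrable_comp_finAppend_iff p q G).2 hG

end AppendIntegral

/-! ### Appended sequences and imaginary-time profiles -/

section Profiles

/-- `Fin.append` of two strictly increasing real sequences, the first below the second, is
strictly increasing. [folklore] -/
theorem strictMono_fin_append {p q : ℕ} {a : Fin p → ℝ} {b : Fin q → ℝ} (ha : StrictMono a)
    (hb : StrictMono b) (hab : ∀ i j, a i < b j) : StrictMono (Fin.append a b) := by
  intro i j hij
  induction i using Fin.addCases with
  | left i =>
    induction j using Fin.addCases with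
    | left j =>
      rw [Fin.append_left, Fin.append_left]
      refine ha ?_
      rw [Fin.lt_def] at hij ⊢
      simpa using hij
    | right j =>
      rw [Fin.append_left, Fin.append_right]
      exact hab i j
  | right i =>
    induction j using Fin.addCases with
    | left j =>
      exfalso
      rw [Fin.lt_def] at hij
      simp only [Fin.val_natAdd, Fin.val_castAdd] at hij
      omega
    | right j =>
      rw [Fin.append_right, Fin.append_right]
      refine hb ?_
      rw [Fin.lt_def] at hij ⊢
      simp only [Fin.val_natAdd] at hij
      simpa using hij

variable {d n : ℕ}

/-- A complex configuration whose imaginary parts are `t_k ê₀` with `t` strictly increasing lies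
in the relative forward tube (successive differences `(t_k − t_{k-1}) ê₀ ∈ V₊`). [folklore] -/
theorem mem_relForwardTube_of_imPart_eq {ζ : Fin n → Fin (d + 1) → ℂ} {t : Fin n → ℝ}
    (h : ∀ k, imPart (ζ k) = t k • e₀ d) (ht : StrictMono t) : ζ ∈ relForwardTube d n := by
  intro k hk
  rw [← succDiff_map imPart imPart_sub ζ k]
  simp only [h]
  rw [succDiff_map (fun s : ℝ => s • e₀ d) (fun a b => sub_smul a b _), smul_e₀_mem_forwardCone_iff]
  cases n with
  | zero => exact k.elim0
  | succ m =>
    obtain ⟨j, rfl⟩ : ∃ j : Fin m, k = j.succ :=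
      ⟨k.pred (fun h0 => by simp [h0] at hk), by simp⟩
    rw [succDiff_succ]
    exact sub_pos.2 (ht (Fin.castSucc_lt_succ))

/-- A complex configuration whose imaginary parts are `t_k ê₀` with `t` strictly increasing and
positive lies in the forward tube. [folklore] -/
theorem mem_forwardTube_of_imPart_eq {ζ : Fin n → Fin (d + 1) → ℂ} {t : Fin n → ℝ}
    (h : ∀ k, imPart (ζ k) = t k • e₀ d) (ht : StrictMono t) (h0 : ∀ k, 0 < t k) :
    ζ ∈ forwardTube d n := by
  rw [mem_forwardTube_iff_imPart_mem_tubeCone]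
  simp only [h, mem_tubeCone_iff]
  intro k
  rw [succDiff_map (fun s : ℝ => s • e₀ d) (fun a b => sub_smul a b _), smul_e₀_mem_forwardCone_iff]
  cases n with
  | zero => exact k.elim0
  | succ m =>
    refine Fin.cases ?_ (fun j => ?_) k
    · simpa using h0 0
    · simpa using ht (Fin.castSucc_lt_succ (i := j))

variable {𝔚 : (Fin n → Fin (d + 1) → ℂ) → ℂ}

/-- The time-shift extension of a holomorphic, imaginary-time-shift invariant function is
holomorphic on the relative forward tube. [folklore] -/
theorem differentiableOn_tubeExtension (h𝔚 : DifferentiableOn ℂ 𝔚 (forwardTube d n))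
    (hinv : ∀ s : ℝ, 0 ≤ s → ∀ z ∈ forwardTube d n, 𝔚 (z + iTimeShift d n s) = 𝔚 z) :
    DifferentiableOn ℂ (tubeExtension 𝔚) (relForwardTube d n) :=
  fun _ hz => (differentiableAt_tubeExtension h𝔚 hinv hz).differentiableWithinAt

/-- … hence continuous there. [folklore] -/
theorem continuousOn_tubeExtension (h𝔚 : DifferentiableOn ℂ 𝔚 (forwardTube d n))
    (hinv : ∀ s : ℝ, 0 ≤ s → ∀ z ∈ forwardTube d n, 𝔚 (z + iTimeShift d n s) = 𝔚 z) :
    ContinuousOn (tubeExtension 𝔚) (relForwardTube d n) :=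
  (differentiableOn_tubeExtension h𝔚 hinv).continuousOn

end Profiles

/-! ### Euclidean configurations: appending, reflecting, profiles -/

section EuclidCfg

variable {d p q : ℕ}

/-- `euclideanPoint` commutes with `Fin.append`. [folklore] -/
theorem euclideanPoint_append (x : Fin p → EuclideanSpace ℝ (Fin (d + 1)))
    (y : Fin q → EuclideanSpace ℝ (Fin (d + 1))) :
    euclideanPoint (Fin.append x y) = Fin.append (euclideanPoint x) (euclideanPoint y) := by
  funext k
  induction k using Fin.addCases with
  | left i => funext μ; simp [euclideanPoint, Fin.append_left]
  | right j => funext μ; simp [euclideanPoint, Fin.append_right]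

/-- The Euclidean point of the time-reflected reversed configuration is the conjugate reversal
of the Euclidean point: `ι(θ x_{p-1}, …, θ x_0) = revConj (ι x)`. [folklore] -/
theorem euclideanPoint_thetaRevShift_zero (x : Fin p → EuclideanSpace ℝ (Fin (d + 1))) :
    euclideanPoint (thetaRevShift 0 x) = revConj (euclideanPoint x) := by
  rw [euclideanPoint_thetaRevShift, iTimeShift_zero, add_zero]

/-- Times of an appended Euclidean configuration `(θ x_{p-1}, …, θ x_0, y_0, …, y_{q-1})` are the
appended sequences `(-x⁰_{p-1}, …, -x⁰_0)` and `(y⁰_0, …)`; if `x, y` are time-ordered they are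
strictly increasing. [folklore] -/
theorem strictMono_time_append_thetaRev {x : Fin p → EuclideanSpace ℝ (Fin (d + 1))}
    {y : Fin q → EuclideanSpace ℝ (Fin (d + 1))} (hx : x ∈ timeOrderedRegion d p)
    (hy : y ∈ timeOrderedRegion d q) :
    StrictMono fun k => Fin.append (thetaRevShift 0 x) y k 0 := by
  have h : (fun k => Fin.append (thetaRevShift 0 x) y k 0) =
      Fin.append (fun i => thetaRevShift 0 x i 0) (fun j => y j 0) := by
    funext k
    induction k using Fin.addCases with
    | left i => simp [Fin.append_left]
    | right j => simp [Fin.append_right]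
  rw [h]
  refine strictMono_fin_append (fun i j hij => ?_) hy.2 (fun i j => ?_)
  · simp only [thetaRevShift_apply_zero, zero_sub, neg_lt_neg_iff]
    exact hx.2 (Fin.rev_lt_rev.2 hij)
  · simp only [thetaRevShift_apply_zero, zero_sub]
    linarith [hx.1 (Fin.rev i), hy.1 j]

/-- The appended Euclidean point `(revConj (ι x), ι y)` of two time-ordered configurations lies
in the relative forward tube. [folklore] -/
theorem append_revConj_euclideanPoint_mem_relForwardTube
    {x : Fin p → EuclideanSpace ℝ (Fin (d + 1))} {y : Fin q → EuclideanSpace ℝ (Fin (d + 1))}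
    (hx : x ∈ timeOrderedRegion d p) (hy : y ∈ timeOrderedRegion d q) :
    Fin.append (revConj (euclideanPoint x)) (euclideanPoint y) ∈ relForwardTube d (p + q) := by
  rw [← euclideanPoint_thetaRevShift_zero, ← euclideanPoint_append]
  exact mem_relForwardTube_of_imPart_eq (fun k => imPart_euclideanPoint _ k)
    (strictMono_time_append_thetaRev hx hy)

/-- … and after an imaginary time shift exceeding all times of `x`, in the forward tube. [folklore] -/
theorem append_revConj_euclideanPoint_add_iTimeShift_mem_forwardTube
    {x : Fin p → EuclideanSpace ℝ (Fin (d + 1))} {y : Fin q → EuclideanSpace ℝ (Fin (d + 1))}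
    (hx : x ∈ timeOrderedRegion d p) (hy : y ∈ timeOrderedRegion d q) {T : ℝ}
    (hT : ∀ k, x k 0 < T) (hT0 : 0 < T) :
    Fin.append (revConj (euclideanPoint x)) (euclideanPoint y) + iTimeShift d (p + q) T ∈
      forwardTube d (p + q) := by
  rw [← euclideanPoint_thetaRevShift_zero, ← euclideanPoint_append, iTimeShift, ← euclideanPoint_add]
  refine mem_forwardTube_of_imPart_eq (t := fun k => Fin.append (thetaRevShift 0 x) y k 0 + T)
    (fun k => ?_) ((strictMono_time_append_thetaRev hx hy).add_const T) (fun k => ?_)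
  · simp [imPart_euclideanPoint, add_smul]
  · induction k using Fin.addCases with
    | left i =>
      simp only [Fin.append_left, thetaRevShift_apply_zero, zero_sub]
      linarith [hT (Fin.rev i)]
    | right j =>
      simp only [Fin.append_right]
      linarith [hy.1 j]

end EuclidCfg

/-! ### The OS kernel -/

section Kernel

variable {d : ℕ}

/-- The **OS kernel** of a family of functions `𝔚ₙ` on complex `n`-point configurations (the
continued Schwinger functions): on the disjoint union of all configuration spaces,
`𝕂 (⟨p, z⟩, ⟨q, w⟩) = 𝔚ext_{p+q} (conj z_{p-1}, …, conj z_0, w_0, …, w_{q-1})`, where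
`𝔚ext = tubeExtension` is the time-shift extension to the relative tube and
`revConj` the conjugate reversal. For the Wightman functions of a QFT this is the Gram kernel
`⟪Φ(z), Φ(w)⟫` of the analytically continued vectors `Φ(w) = φ(w_0) ⋯ φ(w_{q-1}) Ω`
(Glaser (1974), §2; OS I (1973), §4.3, (4.22)–(4.28) at Euclidean points). [cite: GlaserCMP1974, §2] -/
def osKernel (𝔚 : (n : ℕ) → (Fin n → Fin (d + 1) → ℂ) → ℂ) :
    (Σ n, (Fin n → Fin (d + 1) → ℂ)) → (Σ n, (Fin n → Fin (d + 1) → ℂ)) → ℂ :=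
  fun P Q => tubeExtension (𝔚 (P.1 + Q.1)) (Fin.append (revConj P.2) Q.2)

/-- Unfolding the OS kernel. [folklore] -/
theorem osKernel_apply (𝔚 : (n : ℕ) → (Fin n → Fin (d + 1) → ℂ) → ℂ) {p q : ℕ}
    (z : Fin p → Fin (d + 1) → ℂ) (w : Fin q → Fin (d + 1) → ℂ) :
    osKernel 𝔚 ⟨p, z⟩ ⟨q, w⟩ = tubeExtension (𝔚 (p + q)) (Fin.append (revConj z) w) := rfl

variable (d) in
/-- The set of **time-ordered Euclidean points** of all degrees,
`{⟨p, ι x⟩ : 0 < x⁰_0 < ⋯ < x⁰_{p-1}}`. [folklore] -/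
def euclidPts : Set (Σ n, (Fin n → Fin (d + 1) → ℂ)) :=
  {P | ∃ x ∈ timeOrderedRegion d P.1, P.2 = euclideanPoint x}

/-- Membership of a Euclidean point in `euclidPts`. [folklore] -/
theorem mem_euclidPts {p : ℕ} {x : Fin p → EuclideanSpace ℝ (Fin (d + 1))}
    (hx : x ∈ timeOrderedRegion d p) :
    (⟨p, euclideanPoint x⟩ : Σ n, (Fin n → Fin (d + 1) → ℂ)) ∈ euclidPts d :=
  ⟨x, hx, rfl⟩

end Kernel

/-! ### E2 in Gram form -/

section Gram

variable {E : Type*} [NormedAddCommGroup E] [NormedSpace ℝ E]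

/-- Pointwise evaluation of a finite sum of Schwartz functions. [folklore] -/
theorem schwartz_sum_apply {X : Type*} [NormedAddCommGroup X] [NormedSpace ℝ X] {ι : Type*}
    (s : Finset ι) (f : ι → 𝓢(X, ℂ)) (x : X) : (∑ i ∈ s, f i) x = ∑ i ∈ s, f i x := by
  classical
  induction s using Finset.induction_on with
  | empty => simp
  | insert i s his ih => rw [Finset.sum_insert his, Finset.sum_insert his, add_apply, ih]

/-- Transport of an `n`-point test function along an equality of degrees `k = n` (the identity
when `k = n` definitionally; bookkeeping for families with repeated degrees). [folklore] -/
def castTest {k n : ℕ} (h : k = n) (G : 𝓢((Fin k → E), ℂ)) : 𝓢((Fin n → E), ℂ) := h ▸ G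

/-- `castTest rfl = id`. [folklore] -/
@[simp]
theorem castTest_rfl {k : ℕ} (G : 𝓢((Fin k → E), ℂ)) : castTest rfl G = G := rfl

/-- Support of a transported test function. [folklore] -/
theorem castTest_isPositiveTimeMulti {dd : ℕ} [NeZero dd] {k n : ℕ} (h : k = n)
    {G : 𝓢((Fin k → EuclideanSpace ℝ (Fin dd)), ℂ)} (hG : IsPositiveTimeMulti G) :
    IsPositiveTimeMulti (castTest h G) := by
  subst h; exact hG

variable {dd : ℕ} [NeZero dd]

/-- `IsPositiveTimeMulti` is stable under addition. [folklore] -/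
theorem IsPositiveTimeMulti.add' {n : ℕ} {F G : 𝓢((Fin n → EuclideanSpace ℝ (Fin dd)), ℂ)}
    (hF : IsPositiveTimeMulti F) (hG : IsPositiveTimeMulti G) : IsPositiveTimeMulti (F + G) :=
  (tsupport_add (F : (Fin n → EuclideanSpace ℝ (Fin dd)) → ℂ) G).trans (Set.union_subset hF hG)

/-- `IsPositiveTimeMulti` is stable under scalar multiplication. [folklore] -/
theorem IsPositiveTimeMulti.smul' {n : ℕ} {F : 𝓢((Fin n → EuclideanSpace ℝ (Fin dd)), ℂ)}
    (hF : IsPositiveTimeMulti F) (c : ℂ) : IsPositiveTimeMulti (c • F) := by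
  intro x hx
  refine hF ?_
  have : ((c • F : 𝓢(_, ℂ)) : (Fin n → EuclideanSpace ℝ (Fin dd)) → ℂ) =
      c • (F : (Fin n → EuclideanSpace ℝ (Fin dd)) → ℂ) := rfl
  rw [this] at hx
  exact tsupport_smul_subset_right (fun _ => c) _ hx

/-- `IsPositiveTimeMulti` is stable under finite sums. [folklore] -/
theorem IsPositiveTimeMulti.sum' {n : ℕ} {ι : Type*} (s : Finset ι)
    {F : ι → 𝓢((Fin n → EuclideanSpace ℝ (Fin dd)), ℂ)} (hF : ∀ i ∈ s, IsPositiveTimeMulti (F i)) :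
    IsPositiveTimeMulti (∑ i ∈ s, F i) := by
  classical
  induction s using Finset.induction_on with
  | empty => simpa using isPositiveTimeMulti_zero
  | insert i s his ih =>
    rw [Finset.sum_insert his]
    exact IsPositiveTimeMulti.add' (hF i (Finset.mem_insert_self i s))
      (ih fun j hj => hF j (Finset.mem_insert_of_mem hj))

/-- The OS adjoint is conjugate-linear: sums. [folklore] -/
theorem osAdjoint_sum {n : ℕ} {ι : Type*} (s : Finset ι)
    (F : ι → 𝓢((Fin n → EuclideanSpace ℝ (Fin dd)), ℂ)) :
    osAdjoint (∑ i ∈ s, F i) = ∑ i ∈ s, osAdjoint (F i) := by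
  ext x
  simp [osAdjoint_apply, map_sum]

/-- The OS adjoint is conjugate-linear: scalars. [folklore] -/
theorem osAdjoint_smul {n : ℕ} (c : ℂ) (F : 𝓢((Fin n → EuclideanSpace ℝ (Fin dd)), ℂ)) :
    osAdjoint (c • F) = conj c • osAdjoint F := by
  ext x
  simp [osAdjoint_apply]

/-- Bilinearity of `appendTensor`: sums on both sides. [folklore] -/
theorem appendTensor_sum_sum {n m : ℕ} {ι κ : Type*} (s : Finset ι) (t : Finset κ)
    (F : ι → 𝓢((Fin n → E), ℂ)) (G : κ → 𝓢((Fin m → E), ℂ)) :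
    SchwartzMap.appendTensor (∑ i ∈ s, F i) (∑ j ∈ t, G j) =
      ∑ i ∈ s, ∑ j ∈ t, SchwartzMap.appendTensor (F i) (G j) := by
  ext x
  simp only [SchwartzMap.appendTensor_apply, schwartz_sum_apply, Finset.sum_mul_sum]

/-- Bilinearity of `appendTensor`: scalars. [folklore] -/
theorem appendTensor_smul_smul {n m : ℕ} (a b : ℂ) (F : 𝓢((Fin n → E), ℂ)) (G : 𝓢((Fin m → E), ℂ)) :
    SchwartzMap.appendTensor (a • F) (b • G) = (a * b) • SchwartzMap.appendTensor F G := by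
  ext x
  simp only [SchwartzMap.appendTensor_apply, smul_apply, smul_eq_mul]
  ring

/-- `appendTensor` with a zero factor vanishes (left). [folklore] -/
theorem appendTensor_zero_left {n m : ℕ} (G : 𝓢((Fin m → E), ℂ)) :
    SchwartzMap.appendTensor (0 : 𝓢((Fin n → E), ℂ)) G = 0 := by
  ext x; simp [SchwartzMap.appendTensor_apply]

/-- `appendTensor` with a zero factor vanishes (right). [folklore] -/
theorem appendTensor_zero_right {n m : ℕ} (F : 𝓢((Fin n → E), ℂ)) :
    SchwartzMap.appendTensor F (0 : 𝓢((Fin m → E), ℂ)) = 0 := by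
  ext x; simp [SchwartzMap.appendTensor_apply]

open Literature.MathematicalPhysics.QuantumLattice.SchwingerFamily in
/-- **Reflection positivity in Gram form** (Osterwalder–Schrader I (1973), (4.3): "this form is
positive semidefinite due to (E2)"). For an E2-positive Schwinger family, any finite family of
positive-time test functions `G_i` of degrees `n_i` — repetitions of degrees allowed — and
coefficients `c_i`, the Gram sum `∑ᵢ ∑ⱼ conj cᵢ cⱼ 𝔖_{nᵢ+nⱼ}(ΘGᵢ* ⊗ Gⱼ)` is `≥ 0` (in the order of
`ℂ`). Proof: apply E2 to the sequence `f_n = ∑_{i : nᵢ = n} cᵢ Gᵢ` and expand by sesquilinearity.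
[cite: OsterwalderSchraderCMP1973, §4.1 (4.3)] -/
theorem _root_.Literature.MathematicalPhysics.QuantumLattice.SchwingerFamily.IsOSReflectionPositive.sum_nonneg
    {S : SchwingerFamily (EuclideanSpace ℝ (Fin dd))}
    (hS : S.IsOSReflectionPositive) {m : ℕ} (deg : Fin m → ℕ)
    (G : (i : Fin m) → 𝓢((Fin (deg i) → EuclideanSpace ℝ (Fin dd)), ℂ))
    (hG : ∀ i, IsPositiveTimeMulti (G i)) (c : Fin m → ℂ) :
    0 ≤ ∑ i, ∑ j, conj (c i) * c j *
      S (deg i + deg j) (SchwartzMap.appendTensor (osAdjoint (G i)) (G j)) := by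
  classical
  -- the per-degree components and the E2 sequence
  set Fc : (n : ℕ) → Fin m → 𝓢((Fin n → EuclideanSpace ℝ (Fin dd)), ℂ) :=
    fun n i => if h : deg i = n then c i • castTest h (G i) else 0 with hFc_def
  set f : (n : ℕ) → 𝓢((Fin n → EuclideanSpace ℝ (Fin dd)), ℂ) := fun n => ∑ i, Fc n i with hf_def
  set N : ℕ := Finset.univ.sup deg with hN_def
  have hdegN : ∀ i, deg i ≤ N := fun i => Finset.le_sup (Finset.mem_univ i)
  have hFc_pos : ∀ n i, IsPositiveTimeMulti (Fc n i) := by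
    intro n i
    simp only [hFc_def]
    split_ifs with h
    · exact IsPositiveTimeMulti.smul' (castTest_isPositiveTimeMulti h (hG i)) _
    · exact isPositiveTimeMulti_zero
  have hf_pos : ∀ n, IsPositiveTimeMulti (f n) := fun n =>
    IsPositiveTimeMulti.sum' _ fun i _ => hFc_pos n i
  have hFc_zero : ∀ n i, deg i ≠ n → Fc n i = 0 := fun n i h => by
    simp only [hFc_def, dif_neg h]
  have hf_zero : ∀ n, N < n → f n = 0 := fun n hn =>
    Finset.sum_eq_zero fun i _ => hFc_zero n i (by have := hdegN i; omega)
  set H : (a b : ℕ) → 𝓢((Fin (a + b) → EuclideanSpace ℝ (Fin dd)), ℂ) :=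
    fun a b => SchwartzMap.appendTensor (osAdjoint (f a)) (f b) with hH_def
  obtain ⟨hre, him⟩ := hS N f hf_zero hf_pos H (fun a b => isAppendTensorOf_appendTensor _ _)
  -- expand the E2 double sum
  set T : (a b : ℕ) → Fin m → Fin m → ℂ := fun a b i j =>
    S (a + b) (SchwartzMap.appendTensor (osAdjoint (Fc a i)) (Fc b j)) with hT_def
  have hexpand : ∀ a b, S (a + b) (H a b) = ∑ i, ∑ j, T a b i j := by
    intro a b
    simp only [hH_def, hf_def, osAdjoint_sum, appendTensor_sum_sum, map_sum, hT_def]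
  have hT_vanish : ∀ a b i j, ¬ (deg i = a ∧ deg j = b) → T a b i j = 0 := by
    intro a b i j h
    rcases not_and_or.1 h with h | h
    · simp only [hT_def, hFc_zero a i h, osAdjoint_zero, appendTensor_zero_left, map_zero]
    · simp only [hT_def, hFc_zero b j h, appendTensor_zero_right, map_zero]
  have hT_diag : ∀ i j, T (deg i) (deg j) i j = conj (c i) * c j *
      S (deg i + deg j) (SchwartzMap.appendTensor (osAdjoint (G i)) (G j)) := by
    intro i j
    simp only [hT_def, hFc_def, dite_true, castTest_rfl, osAdjoint_smul, appendTensor_smul_smul,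
      map_smul, smul_eq_mul]
  have hsum : ∑ a ∈ Finset.range (N + 1), ∑ b ∈ Finset.range (N + 1), S (a + b) (H a b) =
      ∑ i, ∑ j, conj (c i) * c j *
        S (deg i + deg j) (SchwartzMap.appendTensor (osAdjoint (G i)) (G j)) := by
    calc ∑ a ∈ Finset.range (N + 1), ∑ b ∈ Finset.range (N + 1), S (a + b) (H a b)
        = ∑ a ∈ Finset.range (N + 1), ∑ b ∈ Finset.range (N + 1), ∑ i, ∑ j, T a b i j := by
          simp only [hexpand]
      _ = ∑ ab ∈ Finset.range (N + 1) ×ˢ Finset.range (N + 1),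
            ∑ ij ∈ (Finset.univ : Finset (Fin m)) ×ˢ (Finset.univ : Finset (Fin m)),
              T ab.1 ab.2 ij.1 ij.2 := by
          rw [Finset.sum_product]
          refine Finset.sum_congr rfl fun a _ => Finset.sum_congr rfl fun b _ => ?_
          rw [Finset.sum_product]
      _ = ∑ ij ∈ (Finset.univ : Finset (Fin m)) ×ˢ (Finset.univ : Finset (Fin m)),
            ∑ ab ∈ Finset.range (N + 1) ×ˢ Finset.range (N + 1), T ab.1 ab.2 ij.1 ij.2 :=
          Finset.sum_comm
      _ = ∑ ij ∈ (Finset.univ : Finset (Fin m)) ×ˢ (Finset.univ : Finset (Fin m)),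
            T (deg ij.1) (deg ij.2) ij.1 ij.2 := by
          refine Finset.sum_congr rfl fun ij _ => ?_
          rw [Finset.sum_eq_single (deg ij.1, deg ij.2)]
          · intro ab _ hab
            exact hT_vanish _ _ _ _ (fun h => hab (Prod.ext h.1.symm h.2.symm))
          · intro h
            exact absurd (Finset.mem_product.2 ⟨Finset.mem_range.2 (Nat.lt_succ_of_le (hdegN _)),
              Finset.mem_range.2 (Nat.lt_succ_of_le (hdegN _))⟩) h
      _ = ∑ i, ∑ j, conj (c i) * c j *
            S (deg i + deg j) (SchwartzMap.appendTensor (osAdjoint (G i)) (G j)) := by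
          rw [Finset.sum_product]
          simp only [hT_diag]
  rw [← hsum]
  exact Complex.le_def.2 ⟨by simpa using hre, by simpa using him.symm⟩

end Gram

/-! ### The Schwinger pairing through the continuation -/

section Pairing

variable {d p q : ℕ}

/-- Restriction of an appended configuration to the first block. [folklore] -/
theorem append_comp_castAdd {α : Type*} (x : Fin p → α) (y : Fin q → α) :
    (Fin.append x y) ∘ Fin.castAdd q = x :=
  funext fun i => Fin.append_left x y i

/-- Restriction of an appended configuration to the second block. [folklore] -/
theorem append_comp_natAdd {α : Type*} (x : Fin p → α) (y : Fin q → α) :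
    (Fin.append x y) ∘ Fin.natAdd p = y :=
  funext fun j => Fin.append_right x y j

/-- A configuration is the append of its two blocks. [folklore] -/
theorem append_blocks {α : Type*} (z : Fin (p + q) → α) :
    Fin.append (z ∘ Fin.castAdd q) (z ∘ Fin.natAdd p) = z :=
  Fin.append_castAdd_natAdd

/-- Appending is continuous. [folklore] -/
theorem continuous_fin_append {α : Type*} [TopologicalSpace α] :
    Continuous fun xy : (Fin p → α) × (Fin q → α) => Fin.append xy.1 xy.2 := by
  refine continuous_pi fun k => ?_
  induction k using Fin.addCases with
  | left i =>
    simp only [Fin.append_left]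
    exact (continuous_apply i).comp continuous_fst
  | right j =>
    simp only [Fin.append_right]
    exact (continuous_apply j).comp continuous_snd

/-- The time reflection–reversal `x ↦ (θ x_{p-1}, …, θ x_0)` is continuous. [folklore] -/
theorem continuous_thetaRevShift (s : ℝ) :
    Continuous (thetaRevShift (d := d) (n := p) s) := by
  refine continuous_pi fun k => ?_
  show Continuous fun a : Fin p → EuclideanSpace ℝ (Fin (d + 1)) =>
    timeReflection (d + 1) (a (Fin.rev k)) + EuclideanSpace.single 0 s
  exact ((timeReflection (d + 1)).continuous.comp (continuous_apply (Fin.rev k))).add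
    continuous_const

/-- The OS adjoint evaluated: `(ΘF*)(z) = conj F (θ z_{p-1}, …, θ z_0)`. [folklore] -/
theorem osAdjoint_apply_thetaRevShift [NeZero d] (F : 𝓢((Fin p → EuclideanSpace ℝ (Fin (d + 1))), ℂ))
    (z : Fin p → EuclideanSpace ℝ (Fin (d + 1))) :
    osAdjoint F z = conj (F (thetaRevShift 0 z)) := by
  have h := translateMulti_osAdjoint_apply 0 F z
  rw [translateMulti_apply] at h
  have h0 : (fun i => z i - EuclideanSpace.single (0 : Fin (d + 1)) (0 : ℝ)) = z := by
    funext i; ext μ; simp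
  rwa [h0] at h

/-- An append-tensor product of compactly supported test functions is compactly supported. [folklore] -/
theorem hasCompactSupport_appendTensor {E : Type*} [NormedAddCommGroup E] [NormedSpace ℝ E]
    {F : 𝓢((Fin p → E), ℂ)} {G : 𝓢((Fin q → E), ℂ)}
    (hF : HasCompactSupport (F : (Fin p → E) → ℂ)) (hG : HasCompactSupport (G : (Fin q → E) → ℂ)) :
    HasCompactSupport (SchwartzMap.appendTensor F G : (Fin (p + q) → E) → ℂ) := by
  refine HasCompactSupport.intro ((hF.prod hG).image continuous_fin_append) fun z hz => ?_
  rw [SchwartzMap.appendTensor_apply]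
  by_contra h
  refine hz ⟨(z ∘ Fin.castAdd q, z ∘ Fin.natAdd p), ⟨subset_tsupport _ (left_ne_zero_of_mul h),
    subset_tsupport _ (right_ne_zero_of_mul h)⟩, ?_⟩
  exact append_blocks z

/-- The OS adjoint of a compactly supported test function is compactly supported. [folklore] -/
theorem hasCompactSupport_osAdjoint [NeZero d] {F : 𝓢((Fin p → EuclideanSpace ℝ (Fin (d + 1))), ℂ)}
    (hF : HasCompactSupport (F : (Fin p → EuclideanSpace ℝ (Fin (d + 1))) → ℂ)) :
    HasCompactSupport (osAdjoint F : (Fin p → EuclideanSpace ℝ (Fin (d + 1))) → ℂ) := by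
  refine HasCompactSupport.intro (hF.image (continuous_thetaRevShift 0)) fun z hz => ?_
  rw [osAdjoint_apply_thetaRevShift]
  have : thetaRevShift 0 z ∉ tsupport (F : (Fin p → EuclideanSpace ℝ (Fin (d + 1))) → ℂ) := fun h =>
    hz ⟨thetaRevShift 0 z, h, thetaRevShift_thetaRevShift 0 z⟩
  rw [image_eq_zero_of_notMem_tsupport this, map_zero]

variable [NeZero d]

/-- **Block structure of the support of `ΘF* ⊗ G`.** A point in the topological support of
`ΘF* ⊗ G` is `(θ x_{p-1}, …, θ x_0, y_0, …, y_{q-1})` with `x ∈ tsupport F`, `y ∈ tsupport G`. [folklore] -/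
theorem exists_of_mem_tsupport_appendTensor_osAdjoint
    {F : 𝓢((Fin p → EuclideanSpace ℝ (Fin (d + 1))), ℂ)} {G : 𝓢((Fin q → EuclideanSpace ℝ (Fin (d + 1))), ℂ)}
    {z : Fin (p + q) → EuclideanSpace ℝ (Fin (d + 1))}
    (hz : z ∈ tsupport (SchwartzMap.appendTensor (osAdjoint F) G :
      (Fin (p + q) → EuclideanSpace ℝ (Fin (d + 1))) → ℂ)) :
    ∃ x ∈ tsupport (F : (Fin p → EuclideanSpace ℝ (Fin (d + 1))) → ℂ),
      ∃ y ∈ tsupport (G : (Fin q → EuclideanSpace ℝ (Fin (d + 1))) → ℂ),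
        z = Fin.append (thetaRevShift 0 x) y := by
  set KH : Set (Fin (p + q) → EuclideanSpace ℝ (Fin (d + 1))) :=
    {z | thetaRevShift 0 (z ∘ Fin.castAdd q) ∈ tsupport (F : (Fin p → EuclideanSpace ℝ (Fin (d + 1))) → ℂ) ∧
      z ∘ Fin.natAdd p ∈ tsupport (G : (Fin q → EuclideanSpace ℝ (Fin (d + 1))) → ℂ)} with hKH
  have hc1 : Continuous fun z : Fin (p + q) → EuclideanSpace ℝ (Fin (d + 1)) =>
      thetaRevShift 0 (z ∘ Fin.castAdd q) :=
    (continuous_thetaRevShift 0).comp (continuous_pi fun i => continuous_apply _)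
  have hc2 : Continuous fun z : Fin (p + q) → EuclideanSpace ℝ (Fin (d + 1)) => z ∘ Fin.natAdd p :=
    continuous_pi fun j => continuous_apply _
  have hclosed : IsClosed KH :=
    ((isClosed_tsupport _).preimage hc1).inter ((isClosed_tsupport _).preimage hc2)
  have hsub : tsupport (SchwartzMap.appendTensor (osAdjoint F) G :
      (Fin (p + q) → EuclideanSpace ℝ (Fin (d + 1))) → ℂ) ⊆ KH := by
    refine closure_minimal (fun z hz => ?_) hclosed
    rw [Function.mem_support, SchwartzMap.appendTensor_apply] at hz
    have h1 := left_ne_zero_of_mul hz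
    have h2 := right_ne_zero_of_mul hz
    rw [osAdjoint_apply_thetaRevShift, map_ne_zero] at h1
    exact ⟨subset_tsupport _ h1, subset_tsupport _ h2⟩
  obtain ⟨hx, hy⟩ := hsub hz
  refine ⟨_, hx, _, hy, ?_⟩
  rw [thetaRevShift_thetaRevShift, append_blocks]

/-- **The Schwinger pairing `𝔖_{p+q}(ΘF* ⊗ G)` through the analytic continuation**
(Osterwalder–Schrader I (1973), §4.1 and §4.3: (4.3) "`(f, g) = ∑ 𝔖_{n+m}(Θf* × g)`" evaluated via
(4.12) at Euclidean points; here with H21's continuation `𝔚` of `𝔖_{p+q}` and its time-shift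
extension `𝔚ext = tubeExtension 𝔚`). For compactly supported time-ordered `F` (degree `p`) and
`G` (degree `q`),
`𝔖_{p+q}(ΘF* ⊗ G) = ∫∫ 𝔚ext(conj ι x_{p-1}, …, conj ι x_0, ι y_0, …, ι y_{q-1}) conj F(x) G(y) dx dy`.
Proof: shift by a time `T` exceeding the times of `supp F` (E1) to make `ΘF* ⊗ G` time-ordered,
evaluate with `𝔚` at Euclidean points, undo the shift inside `𝔚` by the definition of `𝔚ext`,
split the integral at the append point and substitute `x ↦ (θ x_{p-1}, …, θ x_0)`. [cite: OsterwalderSchraderCMP1973, §4.3 (4.22)–(4.23)] -/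
theorem schwinger_osPairing_eq_integral {S : SchwingerFamily (EuclideanSpace ℝ (Fin (d + 1)))}
    (hE1 : S.IsEuclideanCovariant) {𝔚 : (Fin (p + q) → Fin (d + 1) → ℂ) → ℂ}
    (h𝔚 : DifferentiableOn ℂ 𝔚 (forwardTube d (p + q)))
    (hS : ∀ F : 𝓢((Fin (p + q) → EuclideanSpace ℝ (Fin (d + 1))), ℂ), IsTimeOrdered F →
      S (p + q) F = ∫ x, 𝔚 (euclideanPoint x) * F x)
    {F : 𝓢((Fin p → EuclideanSpace ℝ (Fin (d + 1))), ℂ)}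
    {G : 𝓢((Fin q → EuclideanSpace ℝ (Fin (d + 1))), ℂ)}
    (hF : IsTimeOrdered F) (hFc : HasCompactSupport (F : (Fin p → EuclideanSpace ℝ (Fin (d + 1))) → ℂ))
    (hG : IsTimeOrdered G) (hGc : HasCompactSupport (G : (Fin q → EuclideanSpace ℝ (Fin (d + 1))) → ℂ)) :
    S (p + q) (SchwartzMap.appendTensor (osAdjoint F) G) =
      ∫ x, ∫ y, tubeExtension 𝔚 (Fin.append (revConj (euclideanPoint x)) (euclideanPoint y)) *
        (conj (F x) * G y) := by
  have hinv := eqOn_forwardTube_add_iTimeShift hE1 h𝔚 hS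
  -- a positive time bound for the support of `F`
  obtain ⟨T₀, hT₀⟩ := exists_forall_apply_zero_lt hFc
  set T : ℝ := max T₀ 1 with hT_def
  have hT : ∀ x ∈ tsupport (F : (Fin p → EuclideanSpace ℝ (Fin (d + 1))) → ℂ), ∀ k, x k 0 < T :=
    fun x hx k => (hT₀ x hx k).trans_le (le_max_left _ _)
  have hT0 : 0 < T := lt_of_lt_of_le one_pos (le_max_right _ _)
  set H := SchwartzMap.appendTensor (osAdjoint F) G with hH_def
  -- geometry of the support of `H`
  have hgeo : ∀ z ∈ tsupport (H : (Fin (p + q) → EuclideanSpace ℝ (Fin (d + 1))) → ℂ),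
      (StrictMono fun k => z k 0) ∧ (∀ k, -T < z k 0) ∧
      euclideanPoint z ∈ relForwardTube d (p + q) ∧
      euclideanPoint z + iTimeShift d (p + q) T ∈ forwardTube d (p + q) := by
    intro z hz
    obtain ⟨x, hx, y, hy, rfl⟩ := exists_of_mem_tsupport_appendTensor_osAdjoint hz
    have hx' : x ∈ timeOrderedRegion d p := hF hx
    have hy' : y ∈ timeOrderedRegion d q := hG hy
    refine ⟨strictMono_time_append_thetaRev hx' hy', fun k => ?_, ?_, ?_⟩
    · induction k using Fin.addCases with
      | left i =>
        rw [Fin.append_left, thetaRevShift_apply_zero, zero_sub, neg_lt_neg_iff]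
        exact hT x hx _
      | right j =>
        rw [Fin.append_right]
        linarith [hy'.1 j]
    · rw [euclideanPoint_append, euclideanPoint_thetaRevShift_zero]
      exact append_revConj_euclideanPoint_mem_relForwardTube hx' hy'
    · rw [euclideanPoint_append, euclideanPoint_thetaRevShift_zero]
      exact append_revConj_euclideanPoint_add_iTimeShift_mem_forwardTube hx' hy' (hT x hx) hT0
  -- Step 1: shift by `T` (E1) and evaluate with `𝔚`
  set c : Fin (p + q) → EuclideanSpace ℝ (Fin (d + 1)) := fun _ => EuclideanSpace.single 0 T with hc
  have hHT : IsTimeOrdered (translateMulti (EuclideanSpace.single 0 T) H) := by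
    intro z' hz'
    have hz : z' - c ∈ tsupport (H : (Fin (p + q) → EuclideanSpace ℝ (Fin (d + 1))) → ℂ) := by
      have hcomp : ((translateMulti (EuclideanSpace.single 0 T) H : 𝓢(_, ℂ)) :
          (Fin (p + q) → EuclideanSpace ℝ (Fin (d + 1))) → ℂ) =
          (H : (Fin (p + q) → EuclideanSpace ℝ (Fin (d + 1))) → ℂ) ∘ (Homeomorph.subRight c) := by
        funext y; rfl
      rw [hcomp, tsupport_comp_eq_preimage] at hz'
      exact hz'
    obtain ⟨hmono, hneg, -, -⟩ := hgeo _ hz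
    have hk : ∀ k, z' k 0 = (z' - c) k 0 + T := fun k => by simp [hc]
    refine ⟨fun k => ?_, fun i j hij => ?_⟩
    · rw [hk]; linarith [hneg k]
    · dsimp only
      rw [hk, hk]; linarith [hmono hij]
  have h1 : S (p + q) H = ∫ z, 𝔚 (euclideanPoint z + iTimeShift d (p + q) T) * H z := by
    rw [← hE1.translateMulti (p + q) (EuclideanSpace.single 0 T) H, hS _ hHT]
    calc ∫ z', 𝔚 (euclideanPoint z') * translateMulti (EuclideanSpace.single 0 T) H z'
        = ∫ z', (fun w => 𝔚 (euclideanPoint w) * H (w - c)) z' := by rfl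
      _ = ∫ z, (fun w => 𝔚 (euclideanPoint w) * H (w - c)) (z + c) :=
          (integral_add_right_eq_self (μ := volume) _ c).symm
      _ = ∫ z, 𝔚 (euclideanPoint z + iTimeShift d (p + q) T) * H z := by
          congr 1; funext z
          simp only [add_sub_cancel_right, euclideanPoint_add, iTimeShift, hc]
  -- Step 2: undo the shift inside `𝔚`
  have h2 : ∫ z, 𝔚 (euclideanPoint z + iTimeShift d (p + q) T) * H z =
      ∫ z, tubeExtension 𝔚 (euclideanPoint z) * H z := by
    congr 1; funext z
    by_cases hz : z ∈ tsupport (H : (Fin (p + q) → EuclideanSpace ℝ (Fin (d + 1))) → ℂ)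
    · obtain ⟨-, -, hrel, hfwd⟩ := hgeo z hz
      rw [tubeExtension_eq hinv hrel hfwd]
    · rw [image_eq_zero_of_notMem_tsupport hz, mul_zero, mul_zero]
  -- Step 3: split at the append point
  have hHc : HasCompactSupport (H : (Fin (p + q) → EuclideanSpace ℝ (Fin (d + 1))) → ℂ) :=
    hasCompactSupport_appendTensor (hasCompactSupport_osAdjoint hFc) hGc
  have hU : IsOpen (euclideanPoint ⁻¹' relForwardTube d (p + q) :
      Set (Fin (p + q) → EuclideanSpace ℝ (Fin (d + 1)))) :=
    isOpen_relForwardTube.preimage continuous_euclideanPoint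
  have hcont : Continuous fun z : Fin (p + q) → EuclideanSpace ℝ (Fin (d + 1)) =>
      tubeExtension 𝔚 (euclideanPoint z) * H z :=
    continuous_mul_of_tsupport_subset hU
      ((continuousOn_tubeExtension h𝔚 hinv).comp continuous_euclideanPoint.continuousOn
        (Set.mapsTo_preimage _ _))
      H.continuous (fun z hz => (hgeo z hz).2.2.1)
  have hint : Integrable fun z : Fin (p + q) → EuclideanSpace ℝ (Fin (d + 1)) =>
      tubeExtension 𝔚 (euclideanPoint z) * H z :=
    hcont.integrable_of_hasCompactSupport hHc.mul_left
  have h3 : ∫ z, tubeExtension 𝔚 (euclideanPoint z) * H z =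
      ∫ x', ∫ y, tubeExtension 𝔚 (Fin.append (euclideanPoint x') (euclideanPoint y)) *
        (osAdjoint F x' * G y) := by
    rw [integral_finAppend_eq_integral_integral p q hint]
    congr 1; funext x'; congr 1; funext y
    rw [euclideanPoint_append, hH_def, SchwartzMap.appendTensor_apply, append_comp_castAdd,
      append_comp_natAdd]
  -- Step 4: substitute `x' = (θ x_{p-1}, …, θ x_0)`
  have h4 : ∫ x', ∫ y, tubeExtension 𝔚 (Fin.append (euclideanPoint x') (euclideanPoint y)) *
        (osAdjoint F x' * G y) =
      ∫ x, ∫ y, tubeExtension 𝔚 (Fin.append (revConj (euclideanPoint x)) (euclideanPoint y)) *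
        (conj (F x) * G y) := by
    rw [← integral_comp_thetaRevShift 0 (fun x' => ∫ y,
      tubeExtension 𝔚 (Fin.append (euclideanPoint x') (euclideanPoint y)) * (osAdjoint F x' * G y))]
    congr 1; funext x
    simp only [euclideanPoint_thetaRevShift_zero, osAdjoint_apply_thetaRevShift,
      thetaRevShift_thetaRevShift]
  rw [h1, h2, h3, h4]

end Pairing

/-! ### Approximate identities against a continuous kernel -/

section ApproxIdentity

variable {X Y : Type*} [TopologicalSpace X] [TopologicalSpace Y]

/-- The topological support of `(x, y) ↦ f x * g y` lies in `tsupport f ×ˢ tsupport g`. [folklore] -/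
theorem tsupport_mul_prod_subset {R : Type*} [MulZeroClass R] [NoZeroDivisors R] (f : X → R) (g : Y → R) :
    tsupport (fun z : X × Y => f z.1 * g z.2) ⊆ tsupport f ×ˢ tsupport g := by
  refine closure_minimal (fun z hz => ?_) ((isClosed_tsupport _).prod (isClosed_tsupport _))
  rw [Function.mem_support] at hz
  exact ⟨subset_tsupport _ (left_ne_zero_of_mul hz), subset_tsupport _ (right_ne_zero_of_mul hz)⟩

end ApproxIdentity

section ApproxIdentityMetric

variable {X Y : Type*} [PseudoMetricSpace X] [PseudoMetricSpace Y] [MeasureSpace X] [MeasureSpace Y]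
  [SigmaFinite (volume : Measure X)] [SigmaFinite (volume : Measure Y)]
  [OpensMeasurableSpace X] [OpensMeasurableSpace Y] [SecondCountableTopologyEither X Y]
  [IsFiniteMeasureOnCompacts (volume : Measure X)] [IsFiniteMeasureOnCompacts (volume : Measure Y)]

/-- **Shrinking approximate identities evaluate a continuous kernel** (two-variable form). If
`g` is continuous on an open `U × V ∋ (a, b)`, `ρₙ ≥ 0`, `ρ'ₙ ≥ 0` are continuous with integral
`1` and supports in balls around `a`, `b` of radii `rₙ → 0`, then
`∫∫ g(x, x') ρₙ(x) ρ'ₙ(x') dx dx' → g(a, b)`. [folklore] -/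
theorem tendsto_integral_integral_mul_approxIdentity (g : X → Y → ℂ) {U : Set X} {V : Set Y}
    (hU : IsOpen U) (hV : IsOpen V) (hg : ContinuousOn (Function.uncurry g) (U ×ˢ V))
    {a : X} (ha : a ∈ U) {b : Y} (hb : b ∈ V)
    (ρ : ℕ → X → ℝ) (ρ' : ℕ → Y → ℝ) (hρc : ∀ n, Continuous (ρ n)) (hρ'c : ∀ n, Continuous (ρ' n))
    (hρ0 : ∀ n x, 0 ≤ ρ n x) (hρ'0 : ∀ n y, 0 ≤ ρ' n y)
    (hρ1 : ∀ n, ∫ x, ρ n x = 1) (hρ'1 : ∀ n, ∫ y, ρ' n y = 1)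
    (hρK : ∀ n, HasCompactSupport (ρ n)) (hρ'K : ∀ n, HasCompactSupport (ρ' n))
    (r : ℕ → ℝ) (hr : Tendsto r atTop (𝓝 0))
    (hρr : ∀ n, tsupport (ρ n) ⊆ closedBall a (r n)) (hρ'r : ∀ n, tsupport (ρ' n) ⊆ closedBall b (r n)) :
    Tendsto (fun n => ∫ x, ∫ y, g x y * ((ρ n x : ℂ) * (ρ' n y : ℂ))) atTop (𝓝 (g a b)) := by
  rw [Metric.tendsto_atTop]
  intro ε hε
  -- uniform closeness of `g` to `g a b` near `(a, b)` inside `U × V`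
  obtain ⟨δ, hδ, hδU, hδV, hclose⟩ : ∃ δ > 0, ball a δ ⊆ U ∧ ball b δ ⊆ V ∧
      ∀ x ∈ ball a δ, ∀ y ∈ ball b δ, ‖g x y - g a b‖ ≤ ε / 2 := by
    have hab : (a, b) ∈ U ×ˢ V := ⟨ha, hb⟩
    have hct : ContinuousAt (Function.uncurry g) (a, b) :=
      (hg (a, b) hab).continuousAt ((hU.prod hV).mem_nhds hab)
    have h1 : ∀ᶠ z in 𝓝 (a, b), ‖Function.uncurry g z - g a b‖ < ε / 2 := by
      have := hct.eventually (Metric.ball_mem_nhds (g a b) (half_pos hε))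
      filter_upwards [this] with z hz
      simpa [dist_eq_norm] using hz
    have h2 : ∀ᶠ z in 𝓝 (a, b), z ∈ U ×ˢ V := (hU.prod hV).mem_nhds hab
    obtain ⟨δ, hδ, hball⟩ := Metric.mem_nhds_iff.1 (h1.and h2)
    refine ⟨δ, hδ, fun x hx => ?_, fun y hy => ?_, fun x hx y hy => ?_⟩
    · have : (x, b) ∈ ball (a, b) δ := by
        rw [mem_ball, Prod.dist_eq, max_lt_iff]; exact ⟨hx, by simpa using hδ⟩
      exact (hball this).2.1
    · have : (a, y) ∈ ball (a, b) δ := by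
        rw [mem_ball, Prod.dist_eq, max_lt_iff]; exact ⟨by simpa using hδ, hy⟩
      exact (hball this).2.2
    · have : (x, y) ∈ ball (a, b) δ := by
        rw [mem_ball, Prod.dist_eq, max_lt_iff]; exact ⟨hx, hy⟩
      exact le_of_lt (hball this).1
  obtain ⟨N, hN⟩ := (Metric.tendsto_atTop.1 hr) δ hδ
  refine ⟨N, fun n hn => ?_⟩
  have hrn : r n < δ := (abs_lt.1 (by simpa [Real.dist_eq] using hN n hn)).2
  have hsuppρ : tsupport (ρ n) ⊆ ball a δ :=
    (hρr n).trans (closedBall_subset_ball hrn)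
  have hsuppρ' : tsupport (ρ' n) ⊆ ball b δ :=
    (hρ'r n).trans (closedBall_subset_ball hrn)
  -- the product test function and the integrand on `X × Y`
  set φ : X × Y → ℂ := fun z => (ρ n z.1 : ℂ) * (ρ' n z.2 : ℂ) with hφ
  have hφc : Continuous φ :=
    (continuous_ofReal.comp ((hρc n).comp continuous_fst)).mul
      (continuous_ofReal.comp ((hρ'c n).comp continuous_snd))
  have hφsupp : tsupport φ ⊆ ball a δ ×ˢ ball b δ := by
    refine (tsupport_mul_prod_subset (fun x => (ρ n x : ℂ)) (fun y => (ρ' n y : ℂ))).trans ?_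
    exact Set.prod_mono ((tsupport_comp_subset ofReal_zero _).trans hsuppρ)
      ((tsupport_comp_subset ofReal_zero _).trans hsuppρ')
  have hφK : HasCompactSupport φ := by
    refine HasCompactSupport.intro' ((hρK n).prod (hρ'K n))
      ((isClosed_tsupport _).prod (isClosed_tsupport _)) fun z hz => ?_
    have : z ∉ tsupport φ := fun h => hz
      ((tsupport_mul_prod_subset (fun x => (ρ n x : ℂ)) (fun y => (ρ' n y : ℂ))).trans
        (Set.prod_mono (tsupport_comp_subset ofReal_zero _) (tsupport_comp_subset ofReal_zero _)) h)
    exact image_eq_zero_of_notMem_tsupport this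
  set f : X × Y → ℂ := fun z => g z.1 z.2 * φ z with hf
  have hUV : ball a δ ×ˢ ball b δ ⊆ U ×ˢ V := Set.prod_mono hδU hδV
  have hfc : Continuous f :=
    continuous_mul_of_tsupport_subset (hU.prod hV) hg hφc (hφsupp.trans hUV)
  have hfi : Integrable f (volume.prod volume) := hfc.integrable_of_hasCompactSupport hφK.mul_left
  -- pass to the product integral
  have hiter : ∫ x, ∫ y, g x y * ((ρ n x : ℂ) * (ρ' n y : ℂ)) = ∫ z, f z ∂(volume.prod volume) :=
    (integral_prod f hfi).symm
  have hφ1 : ∫ z, φ z ∂(volume.prod volume) = 1 := by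
    simp only [hφ]
    rw [integral_prod_mul (fun x => (ρ n x : ℂ)) (fun y => (ρ' n y : ℂ)), integral_complex_ofReal,
      integral_complex_ofReal, hρ1, hρ'1]
    simp
  have hφi : Integrable φ (volume.prod volume) := hφc.integrable_of_hasCompactSupport hφK
  -- the estimate
  have hbound : ∀ z, ‖f z - g a b * φ z‖ ≤ (ε / 2) * (ρ n z.1 * ρ' n z.2) := by
    intro z
    by_cases hz : z ∈ tsupport φ
    · have hz' := hφsupp hz
      simp only [hf]
      rw [← sub_mul, norm_mul]
      have hφnorm : ‖φ z‖ = ρ n z.1 * ρ' n z.2 := by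
        rw [hφ, norm_mul, Complex.norm_real, Complex.norm_real, Real.norm_of_nonneg (hρ0 n _),
          Real.norm_of_nonneg (hρ'0 n _)]
      rw [hφnorm]
      exact mul_le_mul_of_nonneg_right (hclose _ hz'.1 _ hz'.2)
        (mul_nonneg (hρ0 n _) (hρ'0 n _))
    · have h0 : φ z = 0 := image_eq_zero_of_notMem_tsupport hz
      simp only [hf, h0, mul_zero, sub_zero, norm_zero]
      exact mul_nonneg (half_pos hε).le (mul_nonneg (hρ0 n _) (hρ'0 n _))
  have hbi : Integrable (fun z : X × Y => (ε / 2) * (ρ n z.1 * ρ' n z.2)) (volume.prod volume) := by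
    have : Integrable (fun z : X × Y => ρ n z.1 * ρ' n z.2) (volume.prod volume) := by
      have hc : Continuous fun z : X × Y => ρ n z.1 * ρ' n z.2 :=
        ((hρc n).comp continuous_fst).mul ((hρ'c n).comp continuous_snd)
      refine hc.integrable_of_hasCompactSupport ?_
      exact HasCompactSupport.intro' ((hρK n).prod (hρ'K n))
        ((isClosed_tsupport _).prod (isClosed_tsupport _)) fun z hz =>
          image_eq_zero_of_notMem_tsupport (f := fun z : X × Y => ρ n z.1 * ρ' n z.2)
            fun h => hz (tsupport_mul_prod_subset (ρ n) (ρ' n) h)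
    exact this.const_mul _
  rw [dist_eq_norm, hiter]
  calc ‖(∫ z, f z ∂(volume.prod volume)) - g a b‖
      = ‖∫ z, (f z - g a b * φ z) ∂(volume.prod volume)‖ := by
        rw [integral_sub hfi (hφi.const_mul _), integral_const_mul, hφ1, mul_one]
    _ ≤ ∫ z, (ε / 2) * (ρ n z.1 * ρ' n z.2) ∂(volume.prod volume) :=
        norm_integral_le_of_norm_le hbi (Eventually.of_forall hbound)
    _ = ε / 2 := by
        rw [integral_const_mul, integral_prod_mul (fun x => ρ n x) (fun y => ρ' n y), hρ1, hρ'1,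
          mul_one, mul_one]
    _ < ε := half_lt_self hε

end ApproxIdentityMetric

/-! ### Step 1: the OS kernel is positive-semidefinite at Euclidean points -/

section Step1

variable {d : ℕ}

/-- A time-ordered configuration has a closed ball around it inside the time-ordered region. [folklore] -/
theorem exists_closedBall_subset_timeOrderedRegion {p : ℕ} {x : Fin p → EuclideanSpace ℝ (Fin (d + 1))}
    (hx : x ∈ timeOrderedRegion d p) : ∃ R > 0, closedBall x R ⊆ timeOrderedRegion d p := by
  obtain ⟨ε, hε, hball⟩ := Metric.isOpen_iff.1 isOpen_timeOrderedRegion x hx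
  exact ⟨ε / 2, half_pos hε, (closedBall_subset_ball (half_lt_self hε)).trans hball⟩

open Classical in
/-- A radius `R(y) > 0` for every Euclidean configuration `y` (of any degree) such that the closed
ball of radius `R(y)` around a time-ordered `y` stays time-ordered (choice). [folklore] -/
def bumpRadius (y : Σ n, (Fin n → EuclideanSpace ℝ (Fin (d + 1)))) : ℝ :=
  if h : y.2 ∈ timeOrderedRegion d y.1 then
    Classical.choose (exists_closedBall_subset_timeOrderedRegion h) else 1

/-- `bumpRadius y > 0`. [folklore] -/
theorem bumpRadius_pos (y : Σ n, (Fin n → EuclideanSpace ℝ (Fin (d + 1)))) : 0 < bumpRadius y := by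
  classical
  unfold bumpRadius
  split_ifs with h
  · exact (Classical.choose_spec (exists_closedBall_subset_timeOrderedRegion h)).1
  · exact one_pos

/-- The closed ball of radius `bumpRadius y` around a time-ordered `y` is time-ordered. [folklore] -/
theorem closedBall_bumpRadius_subset {y : Σ n, (Fin n → EuclideanSpace ℝ (Fin (d + 1)))}
    (hy : y.2 ∈ timeOrderedRegion d y.1) : closedBall y.2 (bumpRadius y) ⊆ timeOrderedRegion d y.1 := by
  classical
  unfold bumpRadius
  rw [dif_pos hy]
  exact (Classical.choose_spec (exists_closedBall_subset_timeOrderedRegion hy)).2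

/-- The shrinking bump functions at a Euclidean configuration: outer radius `R(y)/(n+1)`. [folklore] -/
def euclidBump (n : ℕ) (y : Σ n, (Fin n → EuclideanSpace ℝ (Fin (d + 1)))) : ContDiffBump y.2 where
  rIn := bumpRadius y / (2 * ((n : ℝ) + 1))
  rOut := bumpRadius y / ((n : ℝ) + 1)
  rIn_pos := div_pos (bumpRadius_pos y) (by positivity)
  rIn_lt_rOut := by
    have h := bumpRadius_pos y
    rw [div_lt_div_iff_of_pos_left h (by positivity) (by positivity)]
    linarith [show (0 : ℝ) < (n : ℝ) + 1 by positivity]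

/-- The normalised shrinking bumps `ρₙ^y ≥ 0`, `∫ ρₙ^y = 1`, `supp ρₙ^y = closedBall y (R(y)/(n+1))`. [folklore] -/
def euclidBumpFn (n : ℕ) (y : Σ n, (Fin n → EuclideanSpace ℝ (Fin (d + 1)))) :
    (Fin y.1 → EuclideanSpace ℝ (Fin (d + 1))) → ℝ :=
  (euclidBump n y).normed volume

/-- Smoothness of the complexified bumps. [folklore] -/
theorem contDiff_euclidBumpFn_ofReal (n : ℕ) (y : Σ n, (Fin n → EuclideanSpace ℝ (Fin (d + 1)))) :
    ContDiff ℝ (⊤ : ℕ∞) fun x => (euclidBumpFn n y x : ℂ) :=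
  ofRealCLM.contDiff.comp (euclidBump n y).contDiff_normed

/-- Compact support of the complexified bumps. [folklore] -/
theorem hasCompactSupport_euclidBumpFn_ofReal (n : ℕ) (y : Σ n, (Fin n → EuclideanSpace ℝ (Fin (d + 1)))) :
    HasCompactSupport fun x => (euclidBumpFn n y x : ℂ) :=
  (euclidBump n y).hasCompactSupport_normed.comp_left Complex.ofReal_zero

/-- The complexified bumps as test functions. [folklore] -/
def euclidBumpTest (n : ℕ) (y : Σ n, (Fin n → EuclideanSpace ℝ (Fin (d + 1)))) :
    𝓢((Fin y.1 → EuclideanSpace ℝ (Fin (d + 1))), ℂ) :=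
  (hasCompactSupport_euclidBumpFn_ofReal n y).toSchwartzMap (contDiff_euclidBumpFn_ofReal n y)

/-- Values of the bump test functions. [folklore] -/
@[simp]
theorem euclidBumpTest_apply (n : ℕ) (y : Σ n, (Fin n → EuclideanSpace ℝ (Fin (d + 1))))
    (x : Fin y.1 → EuclideanSpace ℝ (Fin (d + 1))) :
    euclidBumpTest n y x = (euclidBumpFn n y x : ℂ) := rfl

/-- Support of the bumps. [folklore] -/
theorem tsupport_euclidBumpFn (n : ℕ) (y : Σ n, (Fin n → EuclideanSpace ℝ (Fin (d + 1)))) :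
    tsupport (euclidBumpFn n y) = closedBall y.2 (bumpRadius y / ((n : ℝ) + 1)) :=
  (euclidBump n y).tsupport_normed_eq

/-- Support of the bump test functions. [folklore] -/
theorem tsupport_euclidBumpTest_subset (n : ℕ) (y : Σ n, (Fin n → EuclideanSpace ℝ (Fin (d + 1)))) :
    tsupport (euclidBumpTest n y : (Fin y.1 → EuclideanSpace ℝ (Fin (d + 1))) → ℂ) ⊆
      closedBall y.2 (bumpRadius y) := by
  refine (tsupport_comp_subset Complex.ofReal_zero (euclidBumpFn n y)).trans ?_
  rw [tsupport_euclidBumpFn]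
  exact closedBall_subset_closedBall (div_le_self (bumpRadius_pos y).le
    (by linarith [n.cast_nonneg (α := ℝ)]))

/-- The bump test functions at a time-ordered configuration are time-ordered. [folklore] -/
theorem isTimeOrdered_euclidBumpTest (n : ℕ) {y : Σ n, (Fin n → EuclideanSpace ℝ (Fin (d + 1)))}
    (hy : y.2 ∈ timeOrderedRegion d y.1) : IsTimeOrdered (euclidBumpTest n y) :=
  (tsupport_euclidBumpTest_subset n y).trans (closedBall_bumpRadius_subset hy)

/-- Compact support of the bump test functions. [folklore] -/
theorem hasCompactSupport_euclidBumpTest (n : ℕ) (y : Σ n, (Fin n → EuclideanSpace ℝ (Fin (d + 1)))) :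
    HasCompactSupport (euclidBumpTest n y : (Fin y.1 → EuclideanSpace ℝ (Fin (d + 1))) → ℂ) :=
  hasCompactSupport_euclidBumpFn_ofReal n y

/-- **The regularised Euclidean kernels** `Kₙ(y, y') = ∫∫ 𝕂(ι x, ι x') ρₙ^y(x) ρₙ^{y'}(x') dx dx'`
(the Gram kernel of the OS vectors `v(ρₙ^y)`, OS I (4.3)–(4.4)). [folklore] -/
def euclidKernelApprox (𝔚 : (n : ℕ) → (Fin n → Fin (d + 1) → ℂ) → ℂ) (n : ℕ)
    (y y' : Σ n, (Fin n → EuclideanSpace ℝ (Fin (d + 1)))) : ℂ :=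
  ∫ x, ∫ x', osKernel 𝔚 ⟨y.1, euclideanPoint x⟩ ⟨y'.1, euclideanPoint x'⟩ *
    ((euclidBumpFn n y x : ℂ) * (euclidBumpFn n y' x' : ℂ))

variable [NeZero d]

/-- **Step 1 of the Glaser route: the OS kernel is positive-semidefinite on time-ordered
Euclidean points** (Osterwalder–Schrader I (1973), §4.1 (4.3) "this form is positive semidefinite
due to (E2)", read through the continuation (4.12); Glaser (1974), §2). For a Schwinger family with
E1 and E2 and holomorphic `𝔚ₙ` on the forward tubes reproducing `𝔖ₙ` at Euclidean points, the
kernel `𝕂 (⟨p, z⟩, ⟨q, w⟩) = 𝔚ext_{p+q}(revConj z, w)` satisfies `∑ᵢⱼ conj cᵢ cⱼ 𝕂(Pᵢ, Pⱼ) ≥ 0` for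
all finite families of time-ordered Euclidean points `Pᵢ = ⟨pᵢ, ι xᵢ⟩`. Proof: the regularised
kernels `Kₙ` (bumps of radius `→ 0` around the points) are Gram sums `𝔖(Θρ* ⊗ ρ)` (E2 in Gram
form, `schwinger_osPairing_eq_integral`), and converge to `𝕂` by continuity of `𝔚ext`. [cite: OsterwalderSchraderCMP1973, §4.1 (4.3) and §4.3] -/
theorem isPosSemidefKernelOn_osKernel_euclidPts
    {S : SchwingerFamily (EuclideanSpace ℝ (Fin (d + 1)))}
    (hE1 : S.IsEuclideanCovariant) (hE2 : S.IsOSReflectionPositive)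
    (𝔚 : (n : ℕ) → (Fin n → Fin (d + 1) → ℂ) → ℂ)
    (h𝔚 : ∀ n, DifferentiableOn ℂ (𝔚 n) (forwardTube d n))
    (hS : ∀ n (F : 𝓢((Fin n → EuclideanSpace ℝ (Fin (d + 1))), ℂ)), IsTimeOrdered F →
      S n F = ∫ x, 𝔚 n (euclideanPoint x) * F x) :
    IsPosSemidefKernelOn (osKernel 𝔚) (euclidPts d) := by
  have hinv : ∀ n, ∀ s : ℝ, 0 ≤ s → ∀ z ∈ forwardTube d n, 𝔚 n (z + iTimeShift d n s) = 𝔚 n z :=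
    fun n => eqOn_forwardTube_add_iTimeShift hE1 (h𝔚 n) (hS n)
  -- the kernel pulled back to Euclidean configurations
  set kE : (Σ n, (Fin n → EuclideanSpace ℝ (Fin (d + 1)))) →
      (Σ n, (Fin n → EuclideanSpace ℝ (Fin (d + 1)))) → ℂ :=
    fun y y' => osKernel 𝔚 ⟨y.1, euclideanPoint y.2⟩ ⟨y'.1, euclideanPoint y'.2⟩ with hkE
  set A : Set (Σ n, (Fin n → EuclideanSpace ℝ (Fin (d + 1)))) :=
    {y | y.2 ∈ timeOrderedRegion d y.1} with hA
  suffices hPD : IsPosSemidefKernelOn kE A by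
    intro m P hP c
    choose x hx hPx using hP
    have h := hPD m (fun i => ⟨(P i).1, x i⟩) (fun i => hx i) c
    have hK : ∀ i j, osKernel 𝔚 (P i) (P j) = kE ⟨(P i).1, x i⟩ ⟨(P j).1, x j⟩ := by
      intro i j
      simp only [hkE, osKernel, hPx i, hPx j]
    simpa only [hK] using h
  -- continuity of the kernel at Euclidean points
  have hcont : ∀ p q : ℕ, ContinuousOn
      (Function.uncurry fun (x : Fin p → EuclideanSpace ℝ (Fin (d + 1)))
        (x' : Fin q → EuclideanSpace ℝ (Fin (d + 1))) =>
          osKernel 𝔚 ⟨p, euclideanPoint x⟩ ⟨q, euclideanPoint x'⟩)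
      (timeOrderedRegion d p ×ˢ timeOrderedRegion d q) := by
    intro p q
    have hΨ : Continuous fun z : (Fin p → EuclideanSpace ℝ (Fin (d + 1))) ×
        (Fin q → EuclideanSpace ℝ (Fin (d + 1))) =>
        Fin.append (revConj (euclideanPoint z.1)) (euclideanPoint z.2) :=
      continuous_fin_append.comp ((continuous_revConj.comp
        (continuous_euclideanPoint.comp continuous_fst)).prodMk
          (continuous_euclideanPoint.comp continuous_snd))
    refine (continuousOn_tubeExtension (h𝔚 (p + q)) (hinv (p + q))).comp hΨ.continuousOn ?_
    rintro ⟨x, x'⟩ ⟨hx, hx'⟩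
    exact append_revConj_euclideanPoint_mem_relForwardTube hx hx'
  refine IsPosSemidefKernelOn.of_forall_tendsto (l := atTop) (Kn := euclidKernelApprox 𝔚)
    (fun n => ?_) (fun y hy y' hy' => ?_)
  · -- positivity of the regularised kernels: E2 in Gram form
    intro m y hy c
    have hK : ∀ i j, euclidKernelApprox 𝔚 n (y i) (y j) =
        S ((y i).1 + (y j).1) (SchwartzMap.appendTensor (osAdjoint (euclidBumpTest n (y i)))
          (euclidBumpTest n (y j))) := by
      intro i j
      rw [schwinger_osPairing_eq_integral hE1 (h𝔚 _) (hS _) (isTimeOrdered_euclidBumpTest n (hy i))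
        (hasCompactSupport_euclidBumpTest n (y i)) (isTimeOrdered_euclidBumpTest n (hy j))
        (hasCompactSupport_euclidBumpTest n (y j))]
      simp only [euclidKernelApprox, osKernel, euclidBumpTest_apply, Complex.conj_ofReal]
    simp only [hK]
    exact SchwingerFamily.IsOSReflectionPositive.sum_nonneg hE2 (fun i => (y i).1)
      (fun i => euclidBumpTest n (y i))
      (fun i => (isTimeOrdered_euclidBumpTest n (hy i)).isPositiveTimeMulti) c
  · -- convergence of the regularised kernels
    set R : ℝ := max (bumpRadius y) (bumpRadius y') with hR
    have hlim := tendsto_integral_integral_mul_approxIdentity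
      (fun (x : Fin y.1 → EuclideanSpace ℝ (Fin (d + 1))) (x' : Fin y'.1 → EuclideanSpace ℝ (Fin (d + 1))) =>
        osKernel 𝔚 ⟨y.1, euclideanPoint x⟩ ⟨y'.1, euclideanPoint x'⟩)
      isOpen_timeOrderedRegion isOpen_timeOrderedRegion (hcont y.1 y'.1) hy hy'
      (fun n => euclidBumpFn n y) (fun n => euclidBumpFn n y')
      (fun n => (euclidBump n y).continuous_normed) (fun n => (euclidBump n y').continuous_normed)
      (fun n x => (euclidBump n y).nonneg_normed x) (fun n x => (euclidBump n y').nonneg_normed x)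
      (fun n => (euclidBump n y).integral_normed) (fun n => (euclidBump n y').integral_normed)
      (fun n => (euclidBump n y).hasCompactSupport_normed) (fun n => (euclidBump n y').hasCompactSupport_normed)
      (fun n => R * (1 / ((n : ℝ) + 1))) (by
        simpa using (tendsto_one_div_add_atTop_nhds_zero_nat (𝕜 := ℝ)).const_mul R)
      (fun n => by
        rw [tsupport_euclidBumpFn]
        refine closedBall_subset_closedBall ?_
        rw [mul_one_div]
        exact div_le_div_of_nonneg_right (le_max_left _ _) (by positivity))
      (fun n => by
        rw [tsupport_euclidBumpFn]
        refine closedBall_subset_closedBall ?_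
        rw [mul_one_div]
        exact div_le_div_of_nonneg_right (le_max_right _ _) (by positivity))
    simpa only [euclidKernelApprox] using hlim

end Step1

end Literature.MathematicalPhysics.QuantumFieldTheory
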